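import Summits.AtomisticToContinuum.BoseEinsteinCondensation.Theorems.BECThomsonPrincipleGDTransferDefs
import Summits.AtomisticToContinuum.BoseEinsteinCondensation.Theorems.BECThomsonPrincipleGDTransferWindowLaw
import Summits.AtomisticToContinuum.BoseEinsteinCondensation.Theorems.BECThomsonPrincipleGDTransferChordVariationForms
import Literature.MathematicalPhysics.QuantumManyBody.PeriodicClusteringFromKyFanGap

/-!
# Route `BECThomsonPrinciple`, crux `GDTransfer` (stmt-AtomisticToContinuum-9482), line `dyson-dressed-witness`:
# reduction of the hardest stub to a RELATIVE-DEFECT approximation of the LNSS pair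

Support file of the lead (stub `stub_dressedWitness`, the non-integrable / hard-core half of the crux).
The registered stub asks for a `DressedWitnessFamilyFor v` — directions `ζ₊, ζ₋` per window mode with the
KLS second variation (W2), the first-order response (W3) and the occupation link (W4) up to a defect
budget `d` with window sum `≤ γ√ρ N`.  This file isolates what is GENUINELY asked of the dressing:
`RelativeDefectPairFor v` — per window mode, admissible (finite-form, hence core-safe) directions `ζ₊, ζ₋`
obeying (W2) whose `L²`-distance to the bare LNSS pair `Λ_n†Ψ`, `Λ_nΨ` is RELATIVELY small,
`‖ζ₊ − Λ_n†Ψ‖² + 3‖ζ₋ − Λ_nΨ‖² ≤ γ₀√ρ · (n_n(Ψ) + 1)` — and proves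
`dwf_of_relativeDefect : LNSSAlgebra → RelativeDefectPairFor v → DressedWitnessFamilyFor v`:
(W3) follows from the pairing identities `N σ(ζ₊,Ψ) = ⟨ζ₊, Λ†Ψ⟩`, `N σ(Ψ,ζ₋) = ⟨ΛΨ, ζ₋⟩` (`LNSSAlgebra`)
and the pointwise inequality `2|a||b| ≤ |a|² + |b|²`; (W4) from `‖Λ_nΨ‖² = n_n` and
`|a|² ≤ 2|b|² + 2|a − b|²`; the budget `d(n) := γ₀√ρ(n_n + 1)` has window sum
`≤ γ₀√ρ(N + #window) ≤ γ₀(1 + 26M³/8π³)√ρ N` by Parseval (`Σ_p n_p = N`) and the `ℤ³` window count of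
`…GDTransferWindowLaw` (`windowSum_le_of_pointwise`).  So the open content of the crux for hard cores is
exactly: core-safe approximants of the LNSS pair at √ρ-relative `L²` accuracy with the KLS second
variation — the statement a planner should promote.  All [folklore] bookkeeping; no physics.
-/

noncomputable section

open MeasureTheory Filter
open scoped ENNReal NNReal ComplexConjugate

namespace Summit.AtomisticToContinuum.BoseEinsteinCondensation.Cruxes.GDTransfer.DysonDressedWitness

open Literature.MathematicalPhysics.QuantumManyBody.BoseGas
open Summit.AtomisticToContinuum.BoseEinsteinCondensation.Theorems.GaussianDominationCan.Negative
  (InWindow)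

variable {m : ℕ}

/-- RELATIVE-DEFECT PAIR FOR ONE POTENTIAL (the analytic content of `stub_dressedWitness`): for every
window parameter `M`, constants `ρ₁, c₁, c₂, γ₀, N₁` such that for `N = m+1 ≥ N₁`, `L > 0`, `N ≤ ρ₁L³`,
`E₀ < ∞` there are a radius `R` and a slack `δ > 0` with: for every `δ`-near-minimiser `Ψ` and window mode
`n`, two admissible directions `ζ₊, ζ₋` of mass and energy form `≤ R` with the KLS second variation
(W2) `𝓔(ζ₊) + 𝓔(ζ₋) ≤ E₀(‖ζ₊‖² + ‖ζ₋‖²) + (c₁k_∞² + c₂ρ)(1 + ‖ζ₊‖² + ‖ζ₋‖²)` and the RELATIVE DEFECT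
`‖ζ₊ − Λ_n†Ψ‖² + 3‖ζ₋ − Λ_nΨ‖² ≤ γ₀√ρ · (n_n(Ψ) + 1)` (`ρ = N/L³`). -/
def RelativeDefectPairFor (v : ℝ → ℝ≥0∞) : Prop :=
  ∀ M : ℝ, 0 < M →
    ∃ ρ₁ c₁ c₂ γ₀ : ℝ, 0 < ρ₁ ∧ 0 < c₁ ∧ 0 < c₂ ∧ 0 < γ₀ ∧ ∃ N₁ : ℕ, ∀ m : ℕ, N₁ ≤ m + 1 →
      ∀ L : ℝ, 0 < L → ((m + 1 : ℕ) : ℝ) ≤ ρ₁ * L ^ 3 →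
        periodicGroundStateEnergy v (m + 1) L ≠ ⊤ →
        ∃ R : ℝ, 0 < R ∧ ∃ δ : ℝ≥0∞, 0 < δ ∧ ∀ Ψ : PeriodicTrialState (m + 1) L,
          periodicEnergy v Ψ ≤ periodicGroundStateEnergy v (m + 1) L + δ →
            ∀ n : Fin 3 → ℤ, n ≠ 0 → InWindow M m L n →
              ∃ ζp ζm : Config (m + 1) → ℂ, IsDirection m L ζp ∧ IsDirection m L ζm ∧
                mass L ζp ≤ ENNReal.ofReal R ∧ mass L ζm ≤ ENNReal.ofReal R ∧
                eform v L ζp ≤ ENNReal.ofReal R ∧ eform v L ζm ≤ ENNReal.ofReal R ∧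
                eform v L ζp + eform v L ζm ≤
                    periodicGroundStateEnergy v (m + 1) L * (mass L ζp + mass L ζm) +
                      ENNReal.ofReal
                        ((c₁ * (2 * Real.pi * ‖(fun j => (n j : ℝ))‖ / L) ^ 2 +
                            c₂ * (((m + 1 : ℕ) : ℝ) / L ^ 3)) *
                          (1 + (mass L ζp + mass L ζm).toReal)) ∧
                mass L (fun X => ζp X - lnssUpper m L n Ψ.ψ X) +
                    3 * mass L (fun X => ζm X - lnssLower m L n Ψ.ψ X) ≤
                  ENNReal.ofReal (γ₀ * Real.sqrt (((m + 1 : ℕ) : ℝ) / L ^ 3)) *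
                    (cellOccupation (m + 1) L (planeWaveMode L n) Ψ.ψ + 1)

/-! ## Pointwise and integral inequalities -/

/-- `|a|² ≤ 2|b|² + 2|a − b|²` for the squared `ℝ≥0∞`-norms. [folklore] -/
theorem sq_nnnorm_le_two_mul_add (a b : ℂ) :
    ((‖a‖₊ : ℝ≥0∞)) ^ 2 ≤ 2 * ((‖b‖₊ : ℝ≥0∞)) ^ 2 + 2 * ((‖b - a‖₊ : ℝ≥0∞)) ^ 2 := by
  have key : ‖a‖ ^ 2 ≤ 2 * ‖b‖ ^ 2 + 2 * ‖b - a‖ ^ 2 := by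
    have h1 : ‖a‖ ≤ ‖b‖ + ‖b - a‖ := by
      calc ‖a‖ = ‖b - (b - a)‖ := by rw [sub_sub_cancel]
        _ ≤ ‖b‖ + ‖b - a‖ := norm_sub_le _ _
    nlinarith [h1, norm_nonneg a, norm_nonneg b, norm_nonneg (b - a), sq_nonneg (‖b‖ - ‖b - a‖)]
  have e : ∀ z : ℂ, ((‖z‖₊ : ℝ≥0∞)) ^ 2 = ENNReal.ofReal (‖z‖ ^ 2) := fun z => by
    rw [← ENNReal.coe_pow, ← ENNReal.ofReal_coe_nnreal]
    simp
  rw [e, e, e, ← ENNReal.ofReal_ofNat 2, ← ENNReal.ofReal_mul (by norm_num),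
    ← ENNReal.ofReal_mul (by norm_num), ← ENNReal.ofReal_add (by positivity) (by positivity)]
  exact ENNReal.ofReal_le_ofReal key

/-- `mass a ≤ 2 mass b + 2 mass (b − a)`. [folklore] -/
theorem mass_le_two_mul_add (L : ℝ) (a : Config (m + 1) → ℂ) {b : Config (m + 1) → ℂ}
    (hb : Continuous b) :
    mass L a ≤ 2 * mass L b + 2 * mass L (fun X => b X - a X) := by
  have hmeas : Measurable fun X => (2 : ℝ≥0∞) * ((‖b X‖₊ : ℝ≥0∞)) ^ 2 :=
    ((continuous_nnnorm.comp hb).measurable.coe_nnreal_ennreal.pow_const 2).const_mul 2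
  unfold mass
  calc (∫⁻ X in cellN (m + 1) L, ((‖a X‖₊ : ℝ≥0∞)) ^ 2)
      ≤ ∫⁻ X in cellN (m + 1) L, (2 * ((‖b X‖₊ : ℝ≥0∞)) ^ 2 + 2 * ((‖b X - a X‖₊ : ℝ≥0∞)) ^ 2) :=
        lintegral_mono fun X => sq_nnnorm_le_two_mul_add (a X) (b X)
    _ = 2 * (∫⁻ X in cellN (m + 1) L, ((‖b X‖₊ : ℝ≥0∞)) ^ 2) +
          2 * ∫⁻ X in cellN (m + 1) L, ((‖b X - a X‖₊ : ℝ≥0∞)) ^ 2 := by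
        rw [lintegral_add_left hmeas, lintegral_const_mul' _ _ ENNReal.ofNat_ne_top,
          lintegral_const_mul' _ _ ENNReal.ofNat_ne_top]

/-- The mass of `x ↦ f x − g x` equals the mass of `x ↦ g x − f x`. [folklore] -/
theorem mass_sub_comm (L : ℝ) (f g : Config (m + 1) → ℂ) :
    mass L (fun X => f X - g X) = mass L (fun X => g X - f X) := by
  unfold mass
  refine lintegral_congr fun X => ?_
  rw [← nnnorm_neg, neg_sub]

/-- **The correlation bound** `‖∫ conj(f) g‖ ≤ ½(‖f‖² + ‖g‖²)` on the cell (pointwise `2|f||g| ≤ |f|² + |g|²`;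
no Cauchy–Schwarz needed). [folklore] -/
theorem norm_integral_conj_mul_le (L : ℝ) {f g : Config (m + 1) → ℂ} (hf : Continuous f)
    (hg : Continuous g) :
    ‖∫ X in cellN (m + 1) L, conj (f X) * g X‖ ≤ ((mass L f).toReal + (mass L g).toReal) / 2 := by
  have hint : ∀ {F : Config (m + 1) → ℂ}, Continuous F →
      ∫ X in cellN (m + 1) L, ‖F X‖ ^ 2 = (mass L F).toReal := fun hF =>
    integral_cellN_norm_sq_eq_toReal L hF
  have hif : Integrable (fun X => ‖f X‖ ^ 2) (volume.restrict (cellN (m + 1) L)) :=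
    integrableOn_cellN (hf.norm.pow 2) L
  have hig : Integrable (fun X => ‖g X‖ ^ 2) (volume.restrict (cellN (m + 1) L)) :=
    integrableOn_cellN (hg.norm.pow 2) L
  calc ‖∫ X in cellN (m + 1) L, conj (f X) * g X‖
      ≤ ∫ X in cellN (m + 1) L, ‖conj (f X) * g X‖ := norm_integral_le_integral_norm _
    _ ≤ ∫ X in cellN (m + 1) L, (‖f X‖ ^ 2 + ‖g X‖ ^ 2) / 2 := by
        refine integral_mono_of_nonneg (Eventually.of_forall fun X => norm_nonneg _)
          ((hif.add hig).div_const 2) (Eventually.of_forall fun X => ?_)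
        show ‖conj (f X) * g X‖ ≤ (‖f X‖ ^ 2 + ‖g X‖ ^ 2) / 2
        rw [norm_mul, Complex.norm_conj]
        nlinarith [sq_nonneg (‖f X‖ - ‖g X‖), norm_nonneg (f X), norm_nonneg (g X)]
    _ = ((mass L f).toReal + (mass L g).toReal) / 2 := by
        rw [integral_div, integral_add hif hig, hint hf, hint hg]

/-! ## (W3) and (W4) from a relative defect -/

/-- **(W4) from the number identity**: `n_n = ‖Λ_nΨ‖² ≤ 2‖ζ₋‖² + 2‖ζ₋ − Λ_nΨ‖²`. -/
theorem occupation_le_of_defect {L : ℝ} (hLA : LNSSAlgebra) (hL : 0 < L) (n : Fin 3 → ℤ)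
    (Ψ : PeriodicTrialState (m + 1) L) {ζm : Config (m + 1) → ℂ} (hζ : Continuous ζm) :
    cellOccupation (m + 1) L (planeWaveMode L n) Ψ.ψ ≤
      2 * mass L ζm + 2 * mass L (fun X => ζm X - lnssLower m L n Ψ.ψ X) := by
  obtain ⟨-, -, -, hmass⟩ := hLA m L hL n Ψ
  rw [← hmass]
  exact mass_le_two_mul_add L _ hζ

/-- **(W3) from the pairing identities**: with `D₊ = ζ₊ − Λ†Ψ`, `D₋ = ζ₋ − ΛΨ`,
`N(σ(ζ₊,Ψ) + σ(Ψ,ζ₋)) = ‖ζ₊‖² + ‖ζ₋‖² − ⟨ζ₊, D₊⟩ − ⟨D₋, ζ₋⟩`, and `|⟨ζ₊,D₊⟩| + |⟨D₋,ζ₋⟩| ≤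
½(‖ζ₊‖² + ‖ζ₋‖²) + ½(‖D₊‖² + ‖D₋‖²)`, whence `‖ζ₊‖² + ‖ζ₋‖² ≤ 2N|σ(ζ₊,Ψ) + σ(Ψ,ζ₋)| + ‖D₊‖² + ‖D₋‖²`. -/
theorem mass_add_mass_le_of_defect {L : ℝ} (hLA : LNSSAlgebra) (hL : 0 < L) (n : Fin 3 → ℤ)
    (Ψ : PeriodicTrialState (m + 1) L) {ζp ζm : Config (m + 1) → ℂ} (hp : IsDirection m L ζp)
    (hm' : IsDirection m L ζm) :
    mass L ζp + mass L ζm ≤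
      2 * ENNReal.ofReal (((m + 1 : ℕ) : ℝ) * ‖srcPair m L n ζp Ψ.ψ + srcPair m L n Ψ.ψ ζm‖) +
        (mass L (fun X => ζp X - lnssUpper m L n Ψ.ψ X) +
          mass L (fun X => ζm X - lnssLower m L n Ψ.ψ X)) := by
  obtain ⟨hdirLo, hdirUp, hpair, -⟩ := hLA m L hL n Ψ
  set U : Config (m + 1) → ℂ := lnssUpper m L n Ψ.ψ with hU
  set Lo : Config (m + 1) → ℂ := lnssLower m L n Ψ.ψ with hLo
  have hUc : Continuous U := hdirUp.contDiff.continuous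
  have hLoc : Continuous Lo := hdirLo.contDiff.continuous
  have hpc : Continuous ζp := hp.contDiff.continuous
  have hmc : Continuous ζm := hm'.contDiff.continuous
  set Dp : Config (m + 1) → ℂ := fun X => ζp X - U X with hDp
  set Dm : Config (m + 1) → ℂ := fun X => ζm X - Lo X with hDm
  have hDpc : Continuous Dp := hpc.sub hUc
  have hDmc : Continuous Dm := hmc.sub hLoc
  -- finiteness
  have hMp : mass L ζp ≠ ⊤ := ChordVariation.mass_ne_top_of_continuous hpc
  have hMm : mass L ζm ≠ ⊤ := ChordVariation.mass_ne_top_of_continuous hmc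
  have hMDp : mass L Dp ≠ ⊤ := ChordVariation.mass_ne_top_of_continuous hDpc
  have hMDm : mass L Dm ≠ ⊤ := ChordVariation.mass_ne_top_of_continuous hDmc
  have hcj : ∀ {F : Config (m + 1) → ℂ}, Continuous F → Continuous fun X => conj (F X) :=
    fun hF => Complex.continuous_conj.comp hF
  have hI : ∀ {F G : Config (m + 1) → ℂ}, Continuous F → Continuous G →
      Integrable (fun X => conj (F X) * G X) (volume.restrict (cellN (m + 1) L)) :=
    fun hF hG => integrableOn_cellN ((hcj hF).mul hG) L
  -- the pairing identities
  obtain ⟨h1, -⟩ := hpair ζp hp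
  obtain ⟨-, h2⟩ := hpair ζm hm'
  -- rewrite the two inner products through the defects
  have hintU : ∫ X in cellN (m + 1) L, conj (ζp X) * U X =
      (((mass L ζp).toReal : ℝ) : ℂ) - ∫ X in cellN (m + 1) L, conj (ζp X) * Dp X := by
    have e : ∀ X, conj (ζp X) * U X = conj (ζp X) * ζp X - conj (ζp X) * Dp X := by
      intro X; simp only [hDp]; ring
    simp_rw [e]
    rw [integral_sub (hI hpc hpc) (hI hpc hDpc), integral_cellN_conj_mul_self L hpc]
    rfl
  have hintLo : ∫ X in cellN (m + 1) L, conj (Lo X) * ζm X =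
      (((mass L ζm).toReal : ℝ) : ℂ) - ∫ X in cellN (m + 1) L, conj (Dm X) * ζm X := by
    have e : ∀ X, conj (Lo X) * ζm X = conj (ζm X) * ζm X - conj (Dm X) * ζm X := by
      intro X; simp only [hDm, map_sub]; ring
    simp_rw [e]
    rw [integral_sub (hI hmc hmc) (hI hDmc hmc), integral_cellN_conj_mul_self L hmc]
    rfl
  -- the complex number `N(σ + σ)` and its lower bound
  set E : ℂ := (∫ X in cellN (m + 1) L, conj (ζp X) * Dp X) +
    ∫ X in cellN (m + 1) L, conj (Dm X) * ζm X with hE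
  set Wr : ℝ := (mass L ζp).toReal + (mass L ζm).toReal with hWr
  set Dr : ℝ := (mass L Dp).toReal + (mass L Dm).toReal with hDr
  have hsum : ((m + 1 : ℕ) : ℂ) * (srcPair m L n ζp Ψ.ψ + srcPair m L n Ψ.ψ ζm) = (Wr : ℂ) - E := by
    rw [mul_add, h1, h2, hintU, hintLo, hWr, hE]
    push_cast
    ring
  have hEle : ‖E‖ ≤ (Wr + Dr) / 2 := by
    have hb1 := norm_integral_conj_mul_le L hpc hDpc
    have hb2 := norm_integral_conj_mul_le L hDmc hmc
    calc ‖E‖ ≤ ‖∫ X in cellN (m + 1) L, conj (ζp X) * Dp X‖ +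
          ‖∫ X in cellN (m + 1) L, conj (Dm X) * ζm X‖ := norm_add_le _ _
      _ ≤ ((mass L ζp).toReal + (mass L Dp).toReal) / 2 +
          ((mass L Dm).toReal + (mass L ζm).toReal) / 2 := add_le_add hb1 hb2
      _ = (Wr + Dr) / 2 := by rw [hWr, hDr]; ring
  have hnorm : ((m + 1 : ℕ) : ℝ) * ‖srcPair m L n ζp Ψ.ψ + srcPair m L n Ψ.ψ ζm‖ = ‖(Wr : ℂ) - E‖ := by
    rw [← hsum, norm_mul, Complex.norm_natCast]
  have hWr0 : 0 ≤ Wr := by positivity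
  have hkey : Wr ≤ 2 * ‖(Wr : ℂ) - E‖ + Dr := by
    have h3 : Wr - ‖E‖ ≤ ‖(Wr : ℂ) - E‖ := by
      have := norm_sub_norm_le (Wr : ℂ) E
      rw [Complex.norm_real, Real.norm_of_nonneg hWr0] at this
      linarith
    linarith
  -- back to `ℝ≥0∞`
  have hW : mass L ζp + mass L ζm = ENNReal.ofReal Wr := by
    rw [hWr, ENNReal.ofReal_add ENNReal.toReal_nonneg ENNReal.toReal_nonneg,
      ENNReal.ofReal_toReal hMp, ENNReal.ofReal_toReal hMm]
  have hD : mass L Dp + mass L Dm = ENNReal.ofReal Dr := by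
    rw [hDr, ENNReal.ofReal_add ENNReal.toReal_nonneg ENNReal.toReal_nonneg,
      ENNReal.ofReal_toReal hMDp, ENNReal.ofReal_toReal hMDm]
  rw [hW, hD, hnorm, ← ENNReal.ofReal_ofNat 2, ← ENNReal.ofReal_mul (by norm_num),
    ← ENNReal.ofReal_add (by positivity) (by positivity)]
  exact ENNReal.ofReal_le_ofReal hkey

/-! ## The window sum of the budget `γ₀√ρ (n_n + 1)` -/

/-- A window sum of occupations never exceeds `N`. [folklore] -/
theorem windowSum_occupation_le {L : ℝ} (hL : 0 < L) (M : ℝ) (Ψ : PeriodicTrialState (m + 1) L) :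
    windowSum M m L (fun p => cellOccupation (m + 1) L (planeWaveMode L p) Ψ.ψ) ≤ (m + 1 : ℕ) := by
  rw [← Ψ.tsum_cellOccupation_planeWaveMode hL]
  exact ENNReal.tsum_le_tsum fun p => Set.indicator_le_self _ _ p

/-- A window sum of a constant is at most the constant times `26 J³`, `J = M√ρ L/2π`. [folklore] -/
theorem windowSum_const_le {L : ℝ} (hL : 0 < L) {M : ℝ} (hM : 0 ≤ M) {s : ℝ} (hs : 0 ≤ s) :
    windowSum M m L (fun _ => ENNReal.ofReal s) ≤
      ENNReal.ofReal (26 * s * (M * Real.sqrt (((m + 1 : ℕ) : ℝ) / L ^ 3) * L / (2 * Real.pi)) ^ 3) := by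
  have h := windowSum_le_of_pointwise (m := m) hL hM hs le_rfl (f := fun _ => ENNReal.ofReal s)
    (d := fun _ => 0) (fun n _ _ => by simp)
  simp only [windowSum_zero, mul_zero, zero_mul, add_zero] at h
  exact h

/-- Window sums are additive. [folklore] -/
theorem windowSum_add (M : ℝ) (m : ℕ) (L : ℝ) (f g : (Fin 3 → ℤ) → ℝ≥0∞) :
    windowSum M m L (fun p => f p + g p) = windowSum M m L f + windowSum M m L g := by
  unfold windowSum
  rw [← ENNReal.tsum_add]
  refine tsum_congr fun p => ?_
  by_cases hp : p ∈ {q : Fin 3 → ℤ | q ≠ 0 ∧ InWindow M m L q}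
  · simp only [Set.indicator_of_mem hp]
  · simp only [Set.indicator_of_notMem hp, add_zero]

/-- Window sums are homogeneous. [folklore] -/
theorem windowSum_const_mul (M : ℝ) (m : ℕ) (L : ℝ) (c : ℝ≥0∞) (f : (Fin 3 → ℤ) → ℝ≥0∞) :
    windowSum M m L (fun p => c * f p) = c * windowSum M m L f := by
  unfold windowSum
  rw [← ENNReal.tsum_mul_left]
  refine tsum_congr fun p => ?_
  by_cases hp : p ∈ {q : Fin 3 → ℤ | q ≠ 0 ∧ InWindow M m L q}
  · simp only [Set.indicator_of_mem hp]
  · simp only [Set.indicator_of_notMem hp, mul_zero]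

/-- **The hardest stub reduced** (binder form): a relative-defect pair for `v` gives the witness family
for `v`. -/
theorem dressedWitnessFamilyFor_of_relativeDefectPairFor (hLA : LNSSAlgebra) (v : ℝ → ℝ≥0∞)
    (h : RelativeDefectPairFor v) : DressedWitnessFamilyFor v := by
  intro M hM
  obtain ⟨ρ₁, c₁, c₂, γ₀, hρ₁, hc₁, hc₂, hγ₀, N₁, hfam⟩ := h M hM
  set γ : ℝ := γ₀ * (1 + 26 * M ^ 3 / (8 * Real.pi ^ 3)) with hγdef
  have hγ : 0 < γ := by positivity
  refine ⟨min ρ₁ 1, c₁, c₂, γ, lt_min hρ₁ one_pos, hc₁, hc₂, hγ, N₁, ?_⟩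
  intro m hm L hL hdens hE0
  have hdens₁ : ((m + 1 : ℕ) : ℝ) ≤ ρ₁ * L ^ 3 :=
    hdens.trans (mul_le_mul_of_nonneg_right (min_le_left _ _) (by positivity))
  obtain ⟨R, hR, δ, hδ, hΨ⟩ := hfam m hm L hL hdens₁ hE0
  refine ⟨R, hR, δ, hδ, fun Ψ hnear => ?_⟩
  -- the density and the budget scale
  set ρ' : ℝ := ((m + 1 : ℕ) : ℝ) / L ^ 3 with hρ'
  have hρ'0 : 0 < ρ' := by positivity
  have hρ'1 : ρ' ≤ 1 := by
    rw [hρ', div_le_one (by positivity)]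
    exact hdens.trans (by nlinarith [min_le_right ρ₁ 1, pow_pos hL 3])
  set r : ℝ := Real.sqrt ρ' with hr
  have hr0 : 0 ≤ r := Real.sqrt_nonneg _
  have hr1 : r ≤ 1 := by
    rw [hr]
    exact (Real.sqrt_le_sqrt hρ'1).trans_eq Real.sqrt_one
  set s : ℝ := γ₀ * r with hs
  have hs0 : 0 ≤ s := by positivity
  set occ : (Fin 3 → ℤ) → ℝ≥0∞ := fun p => cellOccupation (m + 1) L (planeWaveMode L p) Ψ.ψ with hocc
  refine ⟨fun p => ENNReal.ofReal s * (occ p + 1), ?_, ?_⟩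
  · -- window sum of the budget
    have hsplit : (fun p => ENNReal.ofReal s * (occ p + 1)) =
        fun p => ENNReal.ofReal s * occ p + ENNReal.ofReal s := by
      funext p; rw [mul_add, mul_one]
    rw [hsplit, windowSum_add, windowSum_const_mul]
    have hA : ENNReal.ofReal s * windowSum M m L occ ≤ ENNReal.ofReal (s * (m + 1 : ℕ)) := by
      calc ENNReal.ofReal s * windowSum M m L occ ≤ ENNReal.ofReal s * ((m + 1 : ℕ) : ℝ≥0∞) := by
            gcongr; exact windowSum_occupation_le hL M Ψ
        _ = ENNReal.ofReal (s * (m + 1 : ℕ)) := by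
            rw [ENNReal.ofReal_mul hs0, ENNReal.ofReal_natCast]
    have hB := windowSum_const_le (m := m) hL hM.le hs0
    refine (add_le_add hA hB).trans ?_
    rw [← ENNReal.ofReal_add (by positivity) (by positivity)]
    refine ENNReal.ofReal_le_ofReal ?_
    -- real arithmetic: `J³ = M³ r³ L³/(8π³)` and `r³ L³ = r (m+1)`
    have hρL : ρ' * L ^ 3 = ((m + 1 : ℕ) : ℝ) := by
      rw [hρ']; field_simp
    have hr2 : r ^ 2 = ρ' := by rw [hr, Real.sq_sqrt hρ'0.le]
    have hJ' : (M * Real.sqrt ρ' * L / (2 * Real.pi)) ^ 3 =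
        M ^ 3 * (r * ((m + 1 : ℕ) : ℝ)) / (8 * Real.pi ^ 3) := by
      rw [← hr]
      have e : (M * r * L / (2 * Real.pi)) ^ 3 = M ^ 3 * (r ^ 2 * L ^ 3) * r / (8 * Real.pi ^ 3) := by
        ring
      rw [e, hr2, hρL]
      ring
    rw [hJ']
    have hNr : (0 : ℝ) ≤ ((m + 1 : ℕ) : ℝ) := by positivity
    have hrr : r * r ≤ r := by nlinarith
    have hpi : 0 < 8 * Real.pi ^ 3 := by positivity
    have key : 26 * s * (M ^ 3 * (r * ((m + 1 : ℕ) : ℝ)) / (8 * Real.pi ^ 3)) ≤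
        γ₀ * (26 * M ^ 3 / (8 * Real.pi ^ 3)) * r * ((m + 1 : ℕ) : ℝ) := by
      rw [hs]
      have e : 26 * (γ₀ * r) * (M ^ 3 * (r * ((m + 1 : ℕ) : ℝ)) / (8 * Real.pi ^ 3)) =
          γ₀ * (26 * M ^ 3 / (8 * Real.pi ^ 3)) * (r * r) * ((m + 1 : ℕ) : ℝ) := by
        ring
      rw [e]
      have hc : 0 ≤ γ₀ * (26 * M ^ 3 / (8 * Real.pi ^ 3)) := by positivity
      nlinarith [mul_le_mul_of_nonneg_left hrr hc, hNr,
        mul_le_mul_of_nonneg_right (mul_le_mul_of_nonneg_left hrr hc) hNr]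
    calc s * ((m + 1 : ℕ) : ℝ) + 26 * s * (M ^ 3 * (r * ((m + 1 : ℕ) : ℝ)) / (8 * Real.pi ^ 3))
        ≤ γ₀ * r * ((m + 1 : ℕ) : ℝ) + γ₀ * (26 * M ^ 3 / (8 * Real.pi ^ 3)) * r * ((m + 1 : ℕ) : ℝ) := by
          rw [hs]; linarith [key]
      _ = γ * Real.sqrt ρ' * (m + 1) := by
          rw [hγdef, ← hr]; push_cast; ring
  · -- the modes
    intro n hn hw
    obtain ⟨ζp, ζm, hdp, hdm, h1, h2, h3, h4, hW2, hdef⟩ := hΨ Ψ hnear n hn hw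
    refine ⟨ζp, ζm, hdp, hdm, h1, h2, h3, h4, hW2, ?_, ?_⟩
    · -- (W3)
      refine (mass_add_mass_le_of_defect hLA hL n Ψ hdp hdm).trans (add_le_add le_rfl ?_)
      refine le_trans ?_ hdef
      exact add_le_add le_rfl (le_mul_of_one_le_left bot_le (by norm_num))
    · -- (W4)
      refine (occupation_le_of_defect hLA hL n Ψ hdm.contDiff.continuous).trans (add_le_add le_rfl ?_)
      refine le_trans ?_ hdef
      calc 2 * mass L (fun X => ζm X - lnssLower m L n Ψ.ψ X)
          ≤ 3 * mass L (fun X => ζm X - lnssLower m L n Ψ.ψ X) := by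
            gcongr; norm_num
        _ ≤ mass L (fun X => ζp X - lnssUpper m L n Ψ.ψ X) +
            3 * mass L (fun X => ζm X - lnssLower m L n Ψ.ψ X) := le_add_self

/-- **The hardest stub reduced** (registered helper `dwf_of_relativeDefect` of `stub_dressedWitness`): the
LNSS algebra and a relative-defect pair for `v` give the witness family for `v`. -/
theorem dwf_of_relativeDefect :
    LNSSAlgebra → ∀ v : ℝ → ℝ≥0∞, RelativeDefectPairFor v → DressedWitnessFamilyFor v :=
  fun hLA v h => dressedWitnessFamilyFor_of_relativeDefectPairFor hLA v h

end Summit.AtomisticToContinuum.BoseEinsteinCondensation.Cruxes.GDTransfer.DysonDressedWitness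

end
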